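import Literature.Topology.FourManifolds.CorkDecompositionMiddleLevel
import Literature.Topology.FourManifolds.HandleSpheres
import HarnessLib

/-!
# The Morgan–Szabó complexity of an h-cobordism between simply connected 4-manifolds

Topic `Literature/Topology/FourManifolds`; definition item `defn-hCobordismComplexity` (route
`SmoothPoincare4/ThreePointSpheres`, item stmt-SmoothPoincare4-7369).

## Sources

* J. W. Morgan, Z. Szabó, *Complexity of 4-dimensional h-cobordisms*, Invent. Math. 136 (1999)
  273–286 [MorganSzabo1999] — the notion (not held; cited through the two restatements below).
* H. R. Schwartz, *A note on the complexity of h-cobordisms*, Algebr. Geom. Topol. 20 (2020)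
  = arXiv:1811.02753, §2 (read, p. 4), the paragraph before Def. 2.3 and **Def. 2.3**: *"any
  h-cobordism `W` from `X` to `X` (and more generally, between any pair of closed,
  simply-connected 4-manifolds) can be built as a handlebody from `X × I` using only handles of
  index 2 and 3 […] There are then two sets of distinguished 2-spheres smoothly embedded in
  `X # n S² × S²`, namely the ascending spheres `A₁, …, A_n` of the 2-handles, and the attaching
  spheres `B₁, …, B_n` of the 3-handles. Since `W` is an h-cobordism, these handles can be slid
  over each other until `Aᵢ · Bⱼ = δᵢⱼ` (and perturbed if necessary so that each pair of spheres
  intersects transversally). **Definition 2.3.** Consider the sum `Σᵢ Σⱼ |Aᵢ ⋔ Bⱼ| - δᵢⱼ`, i.e.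
  the number of "excess" intersection points between the spheres which algebraically cancel. The
  minimum value of this sum over all handlebody structures for `W` with only 2 and 3-handles is
  called the complexity of the h-cobordism `W`"*; and *"an h-cobordism has complexity zero if
  and only if it can be built from `X × I` without adding any handles (and so is diffeomorphic to
  a product)"*.
* R. Ladu, *On h-cobordisms of complexity 2*, arXiv:2501.08750 (2025), §6.1 (read, pp. 15–16):
  *"an h-cobordism as above admits normal handle decompositions `D` with only handles of index 2
  and 3, the complexity of `D` is the number of excess intersections between the attaching
  spheres of the 3-handles and the belt spheres of the 2-handles in the middle level of the
  h-cobordism. `C(Z)` is then defined as the minimum of the complexities among all normal handle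
  decompositions of `Z`. If `C(Z) = 0`, then the handles cancel out and `Z` is diffeomorphic to
  a cylinder"*; `C(Z)` is even and non-negative [MorganSzabo1999].

## Lean rendering

The tree describes a handlebody of a cobordism `c : Cobordism 4 X₁ X₂` with only 2- and 3-handles
by a **two–three Morse function** `f : c.W → ℝ` (every critical point has Morse index `2` and
value `< 1/2` or index `3` and value `> 1/2`; `Cobordism.IsMorseFunction`,
`exists_isMorseFunction_two_three_of_isHCobordism`) together with a **gradient-like vector
field** `ξ` for `f` (`IsGradientLike`, Milnor Def. 3.1); the middle level is `f⁻¹(1/2)`, the belt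
(ascending) sphere of the 2-handle of an index-2 critical point `p` is `f⁻¹(1/2) ∩ unstableSet ξ p`
and the attaching (descending) sphere of the 3-handle of an index-3 critical point `q` is
`f⁻¹(1/2) ∩ stableSet ξ q` (`HandleSpheres.lean`, Milnor Def. 3.9). As in the named fact
`exists_dualSpheres_middleLevel_of_two_three` (`CorkDecompositionMiddleLevel.lean`), the middle
level is presented by a closed 4-manifold `N` smoothly embedded onto `f⁻¹(1/2)` and the two sphere
families by framed families `S`, `P : FramedSphereFamily (𝓡 4) N (Fin k) 2 2` (the framings are the
ones cut out by the handles; the count below only sees the core spheres), *normalised* as in the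
printed definition: `IsAlgebraicallyDual … S.sphere P.sphere` (pairwise transverse, `Sᵢ · Pᵢ = 1`,
`Sᵢ · Pⱼ = 0` for `i ≠ j`).

* `NormalDecomposition c` bundles such data **linked to the handlebody**: `f`, `ξ`, `N`, `ι`,
  enumerations `crit₃`, `crit₂ : Fin k → c.W` of the index-3 and index-2 critical points, and the
  identities `ι(Sᵢ) = f⁻¹(1/2) ∩ stableSet ξ (crit₃ i)`,
  `ι(Pⱼ) = f⁻¹(1/2) ∩ unstableSet ξ (crit₂ j)`.
  (Without this link, minimising over dual sphere families in some level would compute the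
  complexity of a *different* h-cobordism — e.g. the standard dual pairs in `X # k S²×S²` have
  excess `0`.) It also records, as in the fact, that `X₁`/`X₂` are the surgeries on `P`/`S`
  (Milnor Thm. 3.13; a property of every such decomposition).
* `middleLevelExcess S P = Σᵢ Σⱼ #(Sᵢ ∩ Pⱼ) - k`, the printed `Σᵢⱼ (|Aᵢ ⋔ Bⱼ| - δᵢⱼ)`
  (double points counted as pairs of parameters, `doublePoints`; for embedded spheres these are
  the intersection points).
* `hCobordismComplexity c : ℕ∞ = ⨅` over normal decompositions of the excess (Schwartz Def. 2.3
  / Ladu §6.1), and the four-dimensional variant `presentationComplexity X₁ X₂ : ℕ∞ = ⨅` over ALL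
  algebraically dual middle-level presentations of the pair (`MiddleLevelPresentation`, exactly the
  data of the named fact, no cobordism), requested by the route to state its higher rungs.

## Junk values and what is NOT here

* Values in `ℕ∞`: `⊤` iff there is no normal decomposition / no dual presentation. For an
  h-cobordism between simply connected closed smooth 4-manifolds a normal decomposition exists
  (Smale; Milnor Thms. 7.6, 8.1 with the two–three handlebody
  `exists_isMorseFunction_two_three_of_isHCobordism` and the basis theorem) — that finiteness is
  a theorem about these definitions, not proved here; `hCobordismComplexity_ne_top_iff` is not
  claimed. `Set.ncard` returns `0` on an infinite set (excluded by transversality + compactness,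
  again a theorem) and `ℕ`-subtraction truncates (excluded by `Sᵢ · Pᵢ = 1 ⇒ #(Sᵢ ∩ Pᵢ) ≥ 1`).
* Not here: the facts "`C` even, `C = 0 ↔` product" [MorganSzabo1999], "`C = 2 ↔` one pair meeting
  thrice `+,-,+`" [Ladu2025 §6.1], unbounded complexity at `b⁺ ≥ 1` [MorganSzabo1999 Thm 1.1,
  Ladu2025 Thm 1.2] — cite items of the route; and independence of the choice of `ξ`.
-/

open scoped Manifold ContDiff Topology
open Set Function

noncomputable section

namespace Literature.Topology.FourManifolds

universe u

/-- Local notation: `𝔼 n` is the model Euclidean space `EuclideanSpace ℝ (Fin n)`. -/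
local notation "𝔼 " n:arg => EuclideanSpace ℝ (Fin n)

/-- Local notation: `𝕊 n` is the unit sphere in `EuclideanSpace ℝ (Fin (n + 1))`. -/
local notation "𝕊 " n:arg => (Metric.sphere (0 : EuclideanSpace ℝ (Fin (n + 1))) 1)

/-! ### The excess of a pair of sphere families -/

section Excess

variable {N : Type u} [TopologicalSpace N] [ChartedSpace (𝔼 4) N] {k : ℕ}

/-- The **excess** of two families `S`, `P` of `k` framed 2-spheres in a 4-manifold: the total
number of intersection points `Σᵢ Σⱼ #(Sᵢ ∩ Pⱼ)` (double points of the core spheres, counted as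
pairs of parameters — the spheres are embedded) minus `k`; for algebraically dual families this is
Schwartz's `Σᵢⱼ (|Aᵢ ⋔ Bⱼ| - δᵢⱼ)`, "the number of excess intersection points between the spheres
which algebraically cancel" (Morgan–Szabó). [cite: Schwartz2020, Def. 2.3] -/
def middleLevelExcess (S P : FramedSphereFamily (𝓡 4) N (Fin k) 2 2) : ℕ :=
  (∑ i, ∑ j, (doublePoints (S.sphere i) (P.sphere j)).ncard) - k

/-- Unfolding the excess. [cite: Schwartz2020, Def. 2.3] -/
theorem middleLevelExcess_def (S P : FramedSphereFamily (𝓡 4) N (Fin k) 2 2) :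
    middleLevelExcess S P = (∑ i, ∑ j, (doublePoints (S.sphere i) (P.sphere j)).ncard) - k := rfl

end Excess

/-! ### Middle-level presentations of a pair (no cobordism) -/

section Presentation

variable (X₁ X₂ : Type u) [TopologicalSpace X₁] [ChartedSpace (𝔼 4) X₁]
  [TopologicalSpace X₂] [ChartedSpace (𝔼 4) X₂]

/-- An **algebraically dual middle-level presentation** of the pair `(X₁, X₂)`: a closed simply
connected smooth oriented 4-manifold `N`, and two algebraically dual framed families `S`, `P` of
`k` disjoint 2-spheres in `N` such that surgery on `P` gives `X₁` and surgery on `S` gives `X₂` —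
exactly the data produced by the named fact
`Literature.Topology.FourManifolds.exists_dualSpheres_middleLevel_of_two_three` from a two–three
handlebody of an h-cobordism (Kirby 1996 §2; Matveyev 1996, Proof of Theorem), here detached from
any cobordism (the "4-dimensional variant" of route `SmoothPoincare4/ThreePointSpheres`).
[cite: Matveyev1996, Proof of Theorem, sentences 1–6 and Def. 1] -/
structure MiddleLevelPresentation where
  /-- The middle level. -/
  N : Type u
  [topN : TopologicalSpace N]
  [t2N : T2Space N]
  [scN : SecondCountableTopology N]
  [chartN : ChartedSpace (𝔼 4) N]
  [mfdN : IsManifold (𝓡 4) ∞ N]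
  [compactN : CompactSpace N]
  [simplyN : SimplyConnectedSpace N]
  /-- An orientation of the middle level. -/
  oN : SmoothOrientation (𝓡 4) N
  /-- Orientations of the source sphere for the two families. -/
  oS : SmoothOrientation (𝓡 2) (𝕊 2)
  oP : SmoothOrientation (𝓡 2) (𝕊 2)
  /-- The number of spheres in each family (of 2-handles = of 3-handles). -/
  k : ℕ
  /-- The attaching (descending) spheres of the 3-handles. -/
  S : FramedSphereFamily (𝓡 4) N (Fin k) 2 2
  /-- The belt (ascending) spheres of the 2-handles. -/
  P : FramedSphereFamily (𝓡 4) N (Fin k) 2 2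
  /-- Normalisation `Sᵢ · Pⱼ = δᵢⱼ`, general position included. -/
  dual : IsAlgebraicallyDual (𝓡 2) (𝓡 2) (𝓡 4) two_add_two_eq_four oS oP oN S.sphere P.sphere
  /-- `X₁` is `N` surgered along `P`. -/
  isSurgery₁ : P.IsSurgery (𝓡 4) X₁
  /-- `X₂` is `N` surgered along `S`. -/
  isSurgery₂ : S.IsSurgery (𝓡 4) X₂

attribute [instance] MiddleLevelPresentation.topN MiddleLevelPresentation.t2N
  MiddleLevelPresentation.scN MiddleLevelPresentation.chartN MiddleLevelPresentation.mfdN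
  MiddleLevelPresentation.compactN MiddleLevelPresentation.simplyN

/-- The **presentation complexity** of the pair `(X₁, X₂)`: the least excess of an algebraically
dual middle-level presentation of `X₂` from `X₁` (`⊤` if there is none) — the four-dimensional
variant of the Morgan–Szabó complexity used by route `SmoothPoincare4/ThreePointSpheres` to state
its rungs `C = 2, 4, 6, …` (finitely many protocorks below a given complexity, Ladu 2025 §6.1).
[cite: Ladu2025ComplexityTwo, §6.1] -/
def presentationComplexity : ℕ∞ :=
  ⨅ p : MiddleLevelPresentation X₁ X₂, (middleLevelExcess p.S p.P : ℕ∞)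

variable {X₁ X₂} in
/-- Every dual presentation bounds the presentation complexity. [folklore] -/
theorem presentationComplexity_le (p : MiddleLevelPresentation X₁ X₂) :
    presentationComplexity X₁ X₂ ≤ middleLevelExcess p.S p.P :=
  iInf_le _ p

end Presentation

/-! ### Normal decompositions of a cobordism and the Morgan–Szabó complexity -/

section Normal

variable {X₁ X₂ : Type u} [TopologicalSpace X₁] [ChartedSpace (𝔼 4) X₁]
  [TopologicalSpace X₂] [ChartedSpace (𝔼 4) X₂]

/-- A **normal handle decomposition** of the cobordism `c` from `X₁` to `X₂`, read in the middle
level (Schwartz 2020, §2 before Def. 2.3; Ladu 2025, §6.1; Milnor 1965, Def. 3.9–3.11): a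
two–three Morse function `f` on `c` (index-2 critical points below `1/2`, index-3 above) with a
gradient-like vector field `ξ`, a closed simply connected 4-manifold `N` embedded onto the middle
level `f⁻¹(1/2)`, enumerations `crit₃`, `crit₂` of the index-3 and index-2 critical points by
`Fin k`, and framed families `S`, `P` in `N` whose core spheres are the attaching spheres of the
3-handles, `ι(Sᵢ) = f⁻¹(1/2) ∩ stableSet ξ (crit₃ i)`, and the belt spheres of the 2-handles,
`ι(Pⱼ) = f⁻¹(1/2) ∩ unstableSet ξ (crit₂ j)`, normalised (`Sᵢ · Pⱼ = δᵢⱼ`, transverse: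
`IsAlgebraicallyDual`), the two ends being the surgeries on `P` and `S` (Milnor Thm. 3.13).
[cite: Schwartz2020, §2 (paragraph before Def. 2.3)] -/
structure NormalDecomposition (c : Cobordism 4 X₁ X₂) extends MiddleLevelPresentation X₁ X₂ where
  /-- The Morse function of the handlebody. -/
  f : c.W → ℝ
  /-- A gradient-like vector field for `f`. -/
  ξ : Π x : c.W, TangentSpace (𝓡∂ (4 + 1)) x
  isMorseFunction : c.IsMorseFunction f
  isGradientLike : IsGradientLike (𝓡∂ (4 + 1)) f ξ
  /-- Only 2-handles (below `1/2`) and 3-handles (above `1/2`). -/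
  two_three : ∀ z, IsMCriticalPt (𝓡∂ (4 + 1)) f z →
    morseIndex (𝓡∂ (4 + 1)) f z = 2 ∧ f z < 2⁻¹ ∨ morseIndex (𝓡∂ (4 + 1)) f z = 3 ∧ 2⁻¹ < f z
  /-- The middle level `N ≅ f⁻¹(1/2)`. -/
  ι : N → c.W
  isSmoothEmbedding_ι : Manifold.IsSmoothEmbedding (𝓡 4) (𝓡∂ (4 + 1)) ∞ ι
  range_ι : range ι = f ⁻¹' {2⁻¹}
  /-- Enumeration of the index-3 critical points (the 3-handles). -/
  crit₃ : Fin k → c.W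
  injective_crit₃ : Injective crit₃
  range_crit₃ : range crit₃ = {z | IsMCriticalPt (𝓡∂ (4 + 1)) f z ∧ morseIndex (𝓡∂ (4 + 1)) f z = 3}
  /-- Enumeration of the index-2 critical points (the 2-handles). -/
  crit₂ : Fin k → c.W
  injective_crit₂ : Injective crit₂
  range_crit₂ : range crit₂ = {z | IsMCriticalPt (𝓡∂ (4 + 1)) f z ∧ morseIndex (𝓡∂ (4 + 1)) f z = 2}
  /-- `Sᵢ` is the attaching (descending) sphere of the `i`-th 3-handle in the middle level. -/
  image_sphere_S : ∀ i, ι '' range (S.sphere i) = range ι ∩ stableSet (𝓡∂ (4 + 1)) ξ (crit₃ i)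
  /-- `Pⱼ` is the belt (ascending) sphere of the `j`-th 2-handle in the middle level. -/
  image_sphere_P : ∀ j, ι '' range (P.sphere j) = range ι ∩ unstableSet (𝓡∂ (4 + 1)) ξ (crit₂ j)

/-- The **Morgan–Szabó complexity** of the cobordism `c` (an h-cobordism between simply connected
closed smooth 4-manifolds in every use): the least excess `Σᵢⱼ (#(Sᵢ ∩ Pⱼ) - δᵢⱼ)` of the attaching
spheres of the 3-handles against the belt spheres of the 2-handles in the middle level, over all
normal (two–three, algebraically dual) handle decompositions of `c` (Schwartz 2020, Def. 2.3;
Ladu 2025, §6.1; Morgan–Szabó 1999). Valued in `ℕ∞`: `⊤` iff `c` has no normal decomposition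
(never, for such h-cobordisms — Smale/Milnor — but not proved here). `C(c) = 0` iff `c` is a
product; `C` is even [MorganSzabo1999] (facts of the route, not asserted here).
[cite: Schwartz2020, Def. 2.3] -/
def hCobordismComplexity (c : Cobordism 4 X₁ X₂) : ℕ∞ :=
  ⨅ D : NormalDecomposition c, (middleLevelExcess D.S D.P : ℕ∞)

/-- Every normal decomposition bounds the complexity by its excess. [folklore] -/
theorem hCobordismComplexity_le {c : Cobordism 4 X₁ X₂} (D : NormalDecomposition c) :
    hCobordismComplexity c ≤ middleLevelExcess D.S D.P :=
  iInf_le _ D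

/-- The complexity of `c` is at least the presentation complexity of its ends: a normal
decomposition of `c` is in particular a dual middle-level presentation of `(X₁, X₂)`. [folklore] -/
theorem presentationComplexity_le_hCobordismComplexity (c : Cobordism 4 X₁ X₂) :
    presentationComplexity X₁ X₂ ≤ hCobordismComplexity c :=
  le_iInf fun D => presentationComplexity_le D.toMiddleLevelPresentation

/-- The complexity is the least excess: if some normal decomposition has excess `C` and every
normal decomposition has excess `≥ C`, the complexity is `C`. [folklore] -/
theorem hCobordismComplexity_eq_of_forall_le {c : Cobordism 4 X₁ X₂} {C : ℕ}
    (D : NormalDecomposition c) (hD : middleLevelExcess D.S D.P = C)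
    (h : ∀ D' : NormalDecomposition c, C ≤ middleLevelExcess D'.S D'.P) :
    hCobordismComplexity c = C :=
  le_antisymm (hD ▸ hCobordismComplexity_le D) (le_iInf fun D' => by exact_mod_cast h D')

end Normal

end Literature.Topology.FourManifolds
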